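import Summits.CriticalPhenomena.Ising3D.IsingColumnFaceL11CensusSegmentTrg

/-!
# The catalogue census of §7.3 as kernel facts, VI: the covering-radius machine for the transcendental
families `LIN` and `TRG` (cell `pub-ising3x`, seat recog-1; paper §1.6 / §7.3; companion of parts
III `…CensusGaps` (rational tables), IV `…CensusGapsAlg` (sharp `ALG` radius), V `…CensusGapsLinTrg`
(`LIN` / `TRG` at the `10⁻³` scale))

HONEST FRAMING: lottery ticket; floor = tightest certified 3D Ising CFT bounds; no exact-solution
claim without a proof. Island framing: certified exclusion region at stated derivative order and
assumptions; not a determination of the 3D Ising critical exponents beyond that.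

§7.3 (paper of record v1.38) still files ONE census clause: «the sharp hole lengths of those two tables
(the linear-form table `LIN` = `linFamily 12` and the trigonometric table `TRG` = `trgFullFamily 17 32`),
of order 10⁻⁵, stay census numbers» — part V certified them only at the `10⁻³` scale by 142- / 149-member
witness chains, and a sharp certificate at `10⁻⁵` would need `10⁴`-member chains. This module removes the
need for any chain DATA: the kernel ENUMERATES every member of the table whose value can lie in a window
(the vector classes `linVecsFirst` and the monomial classes `trgGBList` / `trgLSList` of the §7.3 census
machines `…CensusSegmentLin` / `…CensusSegmentTrg`, re-targeted to an arbitrary scaled window, with the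
window arithmetic in `ℕ` — the kernel's accelerated arithmetic), SORTS the certified integer enclosures by
lower end (a bottom-up merge sort `msortN`; only `msortN l ⊆ l` is needed and proved), and runs the natural-
number twin `zgapsLE` of part IV's enclosure gap checker `egapsLE` on the sorted list. Soundness is the chain
argument of `egapsLE_sound` (every enclosure contains a member; each enclosure's upper end is within `g` of
the running reference point — the window start, then the largest lower end seen — until the reference point
is within `g` of the window end), assembled over consecutive windows by `partsOK_sound`. NOTHING is claimed
about completeness of the enumeration (it only has to be rich enough for the checks to pass), so the
covering theorems rest on: the landed certified enclosures of the constants (`kZ` / `linZEncl` of `ExclusionSentencesLin`,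
verbatim; `trgGEncl` of
`ExclusionSentencesTrgGamma`, rounded outward to naturals over `10¹⁵` — `trgEnclN`), the table side
conditions of the generated tuples (`linTupleOK_of_mem_linVecsFirst`; `mem_trgGBList_iff`,
`mem_trgLSList_iff`), and the kernel evaluations. Here: the generic machine (`mergeN` / `mergePassN` /
`mergeAllN` / `msortN`, `mem_of_mem_msortN`; `zgapsLE`, `zgapsLE_sound`; `PartsOK`, `partsOK_sound`), the two
window generators with their soundness (`linWin` in units `linU = 10¹⁸·27720` (`27720 = lcm(1..12)`),
`linWin_sound`; the `TRG` twin `trgWin` in units `trgU = 10¹⁵·lcm(1..32)` is in `…CensusRadiiCoreTrg.lean`),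
the window check `linCover` and its real-number meaning (`linCover_part`), and the constants of part VII (gap
constant `linG`; hole window and bounding tuples `linHole{A,B,X,Y}`). The kernel evaluations:
`…CensusRadiiLin{A,B,C,D}.lean`, `…CensusRadiiTrg{A,B,C,D}.lean`; the theorems (sharp radii, widest holes):
`…CensusRadiiLin.lean`, `…CensusRadiiTrg.lean`. Pure arithmetic over landed definitions
and certified enclosures; no certificate, no datum, no σ–ε axiom; nothing is recognised (§1.6); no P(M·)
relevance. Python twins (same integers, same loops, same sort key, same checks): recog-1 gen 52
`twin_radii.py`.
lottery ticket; floor = tightest certified 3D Ising CFT bounds; no exact-solution claim without a proof.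
-/

namespace Summit.CriticalPhenomena.Ising3D
namespace ColumnFaceL11
open Set Literature.MathematicalPhysics.QuantumFieldTheory.ConformalBootstrap3D

/-! ### Generic: merge sort of natural-number enclosures by lower end -/

/-- Merge two lists of pairs of naturals by first component (fuel `n ≥` total length). [folklore] -/
def mergeN : ℕ → List (ℕ × ℕ) → List (ℕ × ℕ) → List (ℕ × ℕ)
  | 0, l₁, l₂ => l₁ ++ l₂
  | _ + 1, [], l₂ => l₂
  | _ + 1, a :: l₁, [] => a :: l₁
  | n + 1, a :: l₁, b :: l₂ =>
      if a.1 ≤ b.1 then a :: mergeN n l₁ (b :: l₂) else b :: mergeN n (a :: l₁) l₂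

/-- `mergeN` only rearranges: its output is contained in `l₁ ++ l₂`. [folklore] -/
theorem mem_mergeN : ∀ (n : ℕ) (l₁ l₂ : List (ℕ × ℕ)) (x : ℕ × ℕ), x ∈ mergeN n l₁ l₂ → x ∈ l₁ ++ l₂
  | 0, l₁, l₂, x, h => by rw [mergeN] at h; exact h
  | n + 1, [], l₂, x, h => by rw [mergeN] at h; exact List.mem_append_right _ h
  | n + 1, a :: l₁, [], x, h => by rw [mergeN] at h; rw [List.append_nil]; exact h
  | n + 1, a :: l₁, b :: l₂, x, h => by
      simp only [mergeN] at h
      split_ifs at h with hab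
      · rcases List.mem_cons.mp h with rfl | h
        · simp
        · have h' := mem_mergeN n l₁ (b :: l₂) x h
          simp only [List.mem_append, List.mem_cons] at h' ⊢
          tauto
      · rcases List.mem_cons.mp h with rfl | h
        · simp
        · have h' := mem_mergeN n (a :: l₁) l₂ x h
          simp only [List.mem_append, List.mem_cons] at h' ⊢
          tauto

/-- One bottom-up pass: merge adjacent runs. [folklore] -/
def mergePassN (n : ℕ) : List (List (ℕ × ℕ)) → List (List (ℕ × ℕ))
  | [] => []
  | [r] => [r]
  | r₁ :: r₂ :: rs => mergeN n r₁ r₂ :: mergePassN n rs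

/-- A pass only rearranges. [folklore] -/
theorem mem_mergePassN (n : ℕ) : ∀ (rs : List (List (ℕ × ℕ))) (x : ℕ × ℕ),
    x ∈ (mergePassN n rs).flatten → x ∈ rs.flatten
  | [], x, h => by rw [mergePassN] at h; exact h
  | [r], x, h => by simpa [mergePassN] using h
  | r₁ :: r₂ :: rs, x, h => by
      simp only [mergePassN, List.flatten_cons, List.mem_append] at h ⊢
      rcases h with h | h
      · have h' := mem_mergeN n r₁ r₂ x h
        rw [List.mem_append] at h'
        tauto
      · exact Or.inr (Or.inr (mem_mergePassN n rs x h))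

/-- Iterate the passes (fuel `k`) until one run is left. [folklore] -/
def mergeAllN (n : ℕ) : ℕ → List (List (ℕ × ℕ)) → List (ℕ × ℕ)
  | 0, rs => rs.flatten
  | k + 1, rs =>
    match rs with
    | [] => []
    | [r] => r
    | r₁ :: r₂ :: rs' => mergeAllN n k (mergePassN n (r₁ :: r₂ :: rs'))

/-- `mergeAllN` only rearranges. [folklore] -/
theorem mem_mergeAllN (n : ℕ) : ∀ (k : ℕ) (rs : List (List (ℕ × ℕ))) (x : ℕ × ℕ),
    x ∈ mergeAllN n k rs → x ∈ rs.flatten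
  | 0, rs, x, h => by simpa [mergeAllN] using h
  | k + 1, [], x, h => by simp [mergeAllN] at h
  | k + 1, [r], x, h => by simpa [mergeAllN] using h
  | k + 1, r₁ :: r₂ :: rs', x, h => by
      simp only [mergeAllN] at h
      exact mem_mergePassN n _ x (mem_mergeAllN n k _ x h)

/-- Bottom-up merge sort of enclosures by lower end (kernel-friendly: structural recursion on constant
fuels `10⁷` merge steps / `40` passes, enough for any list of length `< 10⁷`). [folklore] -/
def msortN (l : List (ℕ × ℕ)) : List (ℕ × ℕ) := mergeAllN 10000000 40 (l.map fun x => [x])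

/-- **`msortN l ⊆ l`** — the only property of the sort the covering argument needs. [folklore] -/
theorem mem_of_mem_msortN {l : List (ℕ × ℕ)} {x : ℕ × ℕ} (h : x ∈ msortN l) : x ∈ l := by
  have h' := mem_mergeAllN 10000000 40 _ x h
  rw [List.mem_flatten] at h'
  obtain ⟨r, hr, hxr⟩ := h'
  rw [List.mem_map] at hr
  obtain ⟨y, hy, rfl⟩ := hr
  rw [List.mem_singleton] at hxr
  subst hxr
  exact hy

/-! ### Generic: the gap checker and the chain argument -/

/-- Natural-number twin of part IV's `egapsLE`: along the list, every enclosure's upper end is within `g` of the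
reference point (the window start, then the largest lower end seen), until the reference point is within `g`
of `hi`. [folklore] -/
def zgapsLE (g : ℕ) : ℕ → List (ℕ × ℕ) → ℕ → Bool
  | x, [], hi => decide (hi ≤ g + x)
  | x, e :: es, hi => decide (hi ≤ g + x) || (decide (e.2 ≤ g + x) && zgapsLE g (max x e.1) es hi)

/-- **Soundness of the gap checker** (the chain argument of `egapsLE_sound`): if `zgapsLE g x L hi = true` and
every enclosure of `L` contains a real number with property `P`, then every real `a` with `x < a` and
`a + g ≤ hi` has such a number in `[a, a + g]`. [folklore] -/
theorem zgapsLE_sound {g hi : ℕ} {P : ℝ → Prop} :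
    ∀ {x : ℕ} {L : List (ℕ × ℕ)}, zgapsLE g x L hi = true →
      (∀ e ∈ L, ∃ w : ℝ, P w ∧ ((e.1 : ℕ) : ℝ) ≤ w ∧ w ≤ ((e.2 : ℕ) : ℝ)) →
      ∀ a : ℝ, ((x : ℕ) : ℝ) < a → a + g ≤ ((hi : ℕ) : ℝ) → ∃ w : ℝ, P w ∧ a ≤ w ∧ w ≤ a + g
  | x, [], h, _, a, hxa, hah => by
      simp only [zgapsLE, decide_eq_true_eq] at h
      have h' : ((hi : ℕ) : ℝ) ≤ g + x := by exact_mod_cast h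
      exfalso; linarith
  | x, e :: es, h, hL, a, hxa, hah => by
      simp only [zgapsLE, Bool.or_eq_true, Bool.and_eq_true, decide_eq_true_eq] at h
      rcases h with h | ⟨h1, h2⟩
      · have h' : ((hi : ℕ) : ℝ) ≤ g + x := by exact_mod_cast h
        exfalso; linarith
      · have h1' : ((e.2 : ℕ) : ℝ) ≤ g + x := by exact_mod_cast h1
        obtain ⟨w, hPw, hlw, hwu⟩ := hL e List.mem_cons_self
        by_cases haw : a ≤ w
        · exact ⟨w, hPw, haw, by linarith⟩
        · have haw : w < a := lt_of_not_ge haw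
          have hx' : ((max x e.1 : ℕ) : ℝ) < a := by
            rw [Nat.cast_max]; exact max_lt hxa (lt_of_le_of_lt hlw haw)
          exact zgapsLE_sound h2 (fun e' he' => hL e' (List.mem_cons_of_mem _ he')) a hx' hah

/-- Consecutive windows `(x, x₁], (x₁, x₂], …`: for each, a checked list of member enclosures with
`hi = x_{k+1} + g`. [folklore] -/
def PartsOK (P : ℝ → Prop) (g : ℕ) : ℕ → List ℕ → Prop
  | _, [] => True
  | x, x' :: Xs => (∃ L : List (ℕ × ℕ), zgapsLE g x L (x' + g) = true ∧
      ∀ e ∈ L, ∃ w : ℝ, P w ∧ ((e.1 : ℕ) : ℝ) ≤ w ∧ w ≤ ((e.2 : ℕ) : ℝ)) ∧ PartsOK P g x' Xs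

/-- Constructor for `PartsOK` on a non-empty boundary list (the first link is exactly what a passed window
check gives, `linCover_part` / `trgCover_part`). [folklore] -/
theorem partsOK_cons {P : ℝ → Prop} {g x x' : ℕ} {Xs : List ℕ}
    (h1 : ∃ L : List (ℕ × ℕ), zgapsLE g x L (x' + g) = true ∧
      ∀ e ∈ L, ∃ w : ℝ, P w ∧ ((e.1 : ℕ) : ℝ) ≤ w ∧ w ≤ ((e.2 : ℕ) : ℝ))
    (hrest : PartsOK P g x' Xs) : PartsOK P g x (x' :: Xs) := by
  unfold PartsOK
  exact ⟨h1, hrest⟩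

/-- `PartsOK` on the empty boundary list. [folklore] -/
theorem partsOK_nil {P : ℝ → Prop} {g x : ℕ} : PartsOK P g x [] := by
  unfold PartsOK; trivial

/-- **Soundness of the window assembly**: every real `a` above the first boundary and below some later
boundary has a `P`-number in `[a, a + g]`. [folklore] -/
theorem partsOK_sound {P : ℝ → Prop} {g : ℕ} : ∀ {x : ℕ} {Xs : List ℕ}, PartsOK P g x Xs →
    ∀ a : ℝ, ((x : ℕ) : ℝ) < a → (∃ z ∈ Xs, a ≤ ((z : ℕ) : ℝ)) → ∃ w : ℝ, P w ∧ a ≤ w ∧ w ≤ a + g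
  | x, [], _, a, _, ⟨z, hz, _⟩ => by simp at hz
  | x, x' :: Xs, hP, a, hxa, ⟨z, hz, haz⟩ => by
      unfold PartsOK at hP
      obtain ⟨⟨L, hc, hL⟩, hrest⟩ := hP
      by_cases hax' : a ≤ ((x' : ℕ) : ℝ)
      · exact zgapsLE_sound hc hL a hxa (by push_cast; linarith)
      · have hax' : ((x' : ℕ) : ℝ) < a := lt_of_not_ge hax'
        have hz' : z ∈ Xs := by
          rcases List.mem_cons.mp hz with rfl | hz
          · exact absurd haz (not_le.mpr hax')
          · exact hz
        exact partsOK_sound hrest a hax' ⟨z, hz', haz⟩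

/-! ### `LIN`: window candidates over the landed scaled enclosures `linZEncl` -/

/-- The unit of the `LIN` machine: `10¹⁸ · 27720` (`27720 = lcm(1, …, 12)`). [folklore] -/
def linU : ℕ := linS * 27720

/-- Per-denominator window data, computed once per window: for `aₓ = 1, …, 12` the multiplier
`m = 27720/aₓ` and the scaled bounds `⌊Wlo/m⌋ + (10¹⁸ − 1)`, `⌊Whi/m⌋`. [folklore] -/
def linPre (Wlo Whi : ℕ) : List (ℕ × ℕ × ℕ) :=
  (List.range' 1 12).map fun ax : ℕ => (27720 / ax, Wlo / (27720 / ax) + (linS - 1), Whi / (27720 / ax))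

/-- Emit the candidates of one `(vector, aₓ)`: `a₀ + 1024 ∈ [lo, hi]` (shifted so that the range arithmetic
stays in `ℕ`), as enclosures `((10¹⁸a₀ + T₁)·m, (10¹⁸a₀ + T₂)·m)` of `linU · value` — guarded to be
non-negative. [folklore] -/
def linEmit (T1 T2 : ℤ) (m lo hi : ℕ) : List (ℕ × ℕ) :=
  if hi < lo then [] else (List.range' lo (hi + 1 - lo)).flatMap fun a0p : ℕ =>
    if 0 ≤ (linS : ℤ) * ((a0p : ℤ) - 1024) + T1 ∧ 0 ≤ (linS : ℤ) * ((a0p : ℤ) - 1024) + T2 then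
      [(((linS : ℤ) * ((a0p : ℤ) - 1024) + T1).toNat * m, ((linS : ℤ) * ((a0p : ℤ) - 1024) + T2).toNat * m)]
    else []

/-- All denominators for one vector with enclosure data `T₁, T₂` (of `10¹⁸·Σcᵢ Kᵢ`) and the non-negative
shifts `T₁' = 1024·10¹⁸ − T₁`, `T₂' = 1024·10¹⁸ − T₂`. [folklore] -/
def linWinT (pre : List (ℕ × ℕ × ℕ)) (T1 T2 : ℤ) (T1' T2' : ℕ) : List (ℕ × ℕ) :=
  pre.flatMap fun q => linEmit T1 T2 q.1 ((q.2.1 + T2') / linS) ((q.2.2 + T1') / linS)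

/-- The window candidates of one coefficient vector `c`. [folklore] -/
def linWinC (pre : List (ℕ × ℕ × ℕ)) (c : List ℤ) : List (ℕ × ℕ) :=
  linWinT pre (linZEncl 0 c).1 (linZEncl 0 c).2 (1024 * (linS : ℤ) - (linZEncl 0 c).1).toNat
    (1024 * (linS : ℤ) - (linZEncl 0 c).2).toNat

/-- All window candidates of `LIN` on the scaled window `[Wlo, Whi]` (over the seven first-index classes
`linVecsFirst` of the §7.3 census machine: exactly the coefficient vectors of the table `linTupleOK 12`).
[folklore] -/
def linWin (Wlo Whi : ℕ) : List (ℕ × ℕ) :=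
  (List.range 7).flatMap fun i => (linVecsFirst i).flatMap (linWinC (linPre Wlo Whi))

/-- `aₓ ∣ 27720` for `aₓ ∈ [1, 12]`. [folklore] -/
theorem dvd_27720 {ax : ℕ} (h1 : 1 ≤ ax) (h2 : ax ≤ 12) : ax ∣ 27720 := by
  interval_cases ax <;> norm_num

/-- **Soundness of the `LIN` generator**: every generated enclosure contains `linU · v` for a member `v` of
`linFamily 12`. [folklore] -/
theorem linWin_sound {Wlo Whi : ℕ} {e : ℕ × ℕ} (he : e ∈ linWin Wlo Whi) :
    ∃ w : ℝ, (∃ v : ℝ, v ∈ linFamily 12 ∧ w = (linU : ℝ) * v) ∧ ((e.1 : ℕ) : ℝ) ≤ w ∧ w ≤ ((e.2 : ℕ) : ℝ) := by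
  unfold linWin at he
  simp only [List.mem_flatMap, List.mem_range] at he
  obtain ⟨i, hi, c, hc, he⟩ := he
  unfold linWinC linWinT at he
  rw [List.mem_flatMap] at he
  obtain ⟨q, hq, he⟩ := he
  unfold linPre at hq
  rw [List.mem_map] at hq
  obtain ⟨ax, hax, rfl⟩ := hq
  rw [List.mem_range'_1] at hax
  have hax1 : 1 ≤ ax := hax.1
  have hax2 : ax ≤ 12 := by omega
  unfold linEmit at he
  simp only at he
  split_ifs at he with hlt
  · simp at he
  rw [List.mem_flatMap] at he
  obtain ⟨a0p, -, he⟩ := he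
  split_ifs at he with hnn
  · rw [List.mem_singleton] at he
    subst he
    obtain ⟨hP1, hP2⟩ := hnn
    set T := linZEncl 0 c with hT
    set a0 : ℤ := (a0p : ℤ) - 1024 with ha0
    have hok := linTupleOK_of_mem_linVecsFirst (by omega) hc (a0 := a0) hax1 hax2
    have hmem := mem_linFamily_of_linTupleOK hok
    obtain ⟨hT1, hT2⟩ := linZEncl_sound 0 c
    set m : ℕ := 27720 / ax with hm
    have hmax : m * ax = 27720 := Nat.div_mul_cancel (dvd_27720 hax1 hax2)
    have hmax' : (m : ℝ) * (ax : ℝ) = 27720 := by exact_mod_cast hmax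
    have hax0 : (0 : ℝ) < ax := by exact_mod_cast hax1
    have hm0 : (0 : ℝ) ≤ m := by positivity
    have key : (linU : ℝ) * lin7TupleVal (a0, c, ax) =
        (m : ℝ) * ((linS : ℝ) * (a0 : ℝ) + (linS : ℝ) * lin7Val 0 c) := by
      have e : (linU : ℝ) = (linS : ℝ) * ((m : ℝ) * (ax : ℝ)) := by
        rw [hmax']; unfold linU; push_cast; ring
      unfold lin7TupleVal
      simp only
      calc (linU : ℝ) * (((a0 : ℝ) + lin7Val 0 c) / (ax : ℝ))
          = (linS : ℝ) * ((m : ℝ) * (ax : ℝ)) * (((a0 : ℝ) + lin7Val 0 c) / (ax : ℝ)) := by rw [e]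
        _ = (m : ℝ) * ((linS : ℝ) * (a0 : ℝ) + (linS : ℝ) * lin7Val 0 c) * ((ax : ℝ) / (ax : ℝ)) := by ring
        _ = (m : ℝ) * ((linS : ℝ) * (a0 : ℝ) + (linS : ℝ) * lin7Val 0 c) := by
            rw [div_self hax0.ne', mul_one]
    have c1 : ((((linS : ℤ) * a0 + T.1).toNat : ℕ) : ℝ) = (linS : ℝ) * (a0 : ℝ) + (T.1 : ℝ) := by
      have h := Int.toNat_of_nonneg hP1
      have h' : ((((linS : ℤ) * a0 + T.1).toNat : ℤ) : ℝ) = (((linS : ℤ) * a0 + T.1 : ℤ) : ℝ) := by rw [h]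
      push_cast at h'
      exact h'
    have c2 : ((((linS : ℤ) * a0 + T.2).toNat : ℕ) : ℝ) = (linS : ℝ) * (a0 : ℝ) + (T.2 : ℝ) := by
      have h := Int.toNat_of_nonneg hP2
      have h' : ((((linS : ℤ) * a0 + T.2).toNat : ℤ) : ℝ) = (((linS : ℤ) * a0 + T.2 : ℤ) : ℝ) := by rw [h]
      push_cast at h'
      exact h'
    refine ⟨(linU : ℝ) * lin7TupleVal (a0, c, ax), ⟨_, hmem, rfl⟩, ?_, ?_⟩
    · rw [key]; push_cast; rw [c1]
      nlinarith [mul_le_mul_of_nonneg_left hT1 hm0]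
    · rw [key]; push_cast; rw [c2]
      nlinarith [mul_le_mul_of_nonneg_left hT2 hm0]
  · simp at he

/-- The covering check of one `LIN` window `(x, hi − g]`: generate on `[x, hi]`, sort, check gaps. [folklore] -/
def linCover (g x hi : ℕ) : Bool := zgapsLE g x (msortN (linWin x hi)) hi

/-- What a passed `LIN` window check means (one `PartsOK` link). [folklore] -/
theorem linCover_part {g x x' : ℕ} (h : linCover g x (x' + g) = true) :
    ∃ L : List (ℕ × ℕ), zgapsLE g x L (x' + g) = true ∧
      ∀ e ∈ L, ∃ w : ℝ, (∃ v : ℝ, v ∈ linFamily 12 ∧ w = (linU : ℝ) * v) ∧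
        ((e.1 : ℕ) : ℝ) ≤ w ∧ w ≤ ((e.2 : ℕ) : ℝ) :=
  ⟨_, h, fun _ he => linWin_sound (mem_of_mem_msortN he)⟩

/-- The gap constant of part VII in units of `linU`: the certified upper bound `y.hi − x.lo` of the widest
hole (`353773255804333260 / linU = 1.27623829655…·10⁻⁵`). [folklore] -/
def linG : ℕ := 353773255804333260

/-- The hole window of part VII: `[1.367205335, 1.367218098]`. [folklore] -/
def linHoleA : ℚ := 1367205335 / 10 ^ 9

/-- See `linHoleA`. [folklore] -/
def linHoleB : ℚ := 1367218098 / 10 ^ 9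

/-- The left bounding tuple of the widest `LIN` hole: `x = (14 − 7 log 2 + 7 ζ(5))/12`. [folklore] -/
def linHoleX : ℤ × List ℤ × ℕ := (14, [0, 0, 0, -7, 0, 7, 0], 12)

/-- The right bounding tuple of the widest `LIN` hole: `y = (−90 + 3π³ + 10 ζ(3))/11`. [folklore] -/
def linHoleY : ℤ × List ℤ × ℕ := (-90, [0, 0, 3, 0, 10, 0, 0], 11)

end ColumnFaceL11
end Summit.CriticalPhenomena.Ising3D
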